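import Mathlib.RingTheory.TensorProduct.Basic
import Mathlib.RingTheory.Flat.FaithfullyFlat.Basic
import Mathlib.RingTheory.Ideal.Quotient.Operations
import Mathlib.Algebra.Algebra.ZMod
import Mathlib.Algebra.CharP.Algebra
import Summits.PneNP.PneNP.Theorems.ConvexRankGatesLinAlgGateBlindDetCompress

/-!
# Route ConvexRankGates, crux `LinAlgGateBlind` (stmt-PneNP-10681): one field per characteristic

Support lemma for the crux. A GRANK gate carries ITS OWN field (`IsGRankGate s g : ∃ F, …`), so a circuit over the
crux basis may use a different field at every gate ("wild constants"). This file proves the normalisation every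
composition / refutation argument about GRANK gates starts from: finitely many fields of the SAME characteristic embed
into ONE common field (amalgamation: `F₁ ⊗_𝕜 F₂` over the prime field modulo a maximal ideal), and base change along a
field embedding does not change a GRANK gate (`le_rank_symbolicMatrix_map_iff`, DetCompress). Hence, gate by gate, all
GRANK gates of one characteristic in a circuit may be taken over a single field; different characteristics remain
genuinely different. No new definitions. [folklore]
-/

-- `Summit.PneNP.PneNP.…` duplicates `PneNP` BY DESIGN (single-problem summit).
set_option linter.dupNamespace false

noncomputable section

namespace Summit.PneNP.PneNP.Theorems

open scoped TensorProduct
open Literature.Computability.Complexity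

/-! ### Amalgamation of fields of equal characteristic -/

/-- Two algebras over a field `𝕜` that are fields embed into a common field: `F₁ ⊗_𝕜 F₂` is non-trivial (free,
hence faithfully flat, tensor factors), so it has a maximal ideal `𝔪`, and `(F₁ ⊗_𝕜 F₂) ⧸ 𝔪` receives both.
[folklore] -/
theorem exists_field_hom_hom_of_algebra (𝕜 F₁ F₂ : Type) [Field 𝕜] [Field F₁] [Field F₂] [Algebra 𝕜 F₁]
    [Algebra 𝕜 F₂] : ∃ (F : Type) (_ : Field F), Nonempty (F₁ →+* F) ∧ Nonempty (F₂ →+* F) := by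
  obtain ⟨𝔪, h𝔪⟩ := Ideal.exists_maximal (F₁ ⊗[𝕜] F₂)
  exact ⟨(F₁ ⊗[𝕜] F₂) ⧸ 𝔪, Ideal.Quotient.field 𝔪,
    ⟨(Ideal.Quotient.mk 𝔪).comp (Algebra.TensorProduct.includeLeft (S := 𝕜) : F₁ →ₐ[𝕜] F₁ ⊗[𝕜] F₂)⟩,
    ⟨(Ideal.Quotient.mk 𝔪).comp (Algebra.TensorProduct.includeRight : F₂ →ₐ[𝕜] F₁ ⊗[𝕜] F₂)⟩⟩

/-- **Amalgamation.** Two fields of the same characteristic embed into a common field (over the prime field `ℚ`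
or `𝔽_p`). [folklore] -/
theorem exists_field_hom_hom_of_ringChar_eq (F₁ F₂ : Type) [Field F₁] [Field F₂]
    (h : ringChar F₁ = ringChar F₂) :
    ∃ (F : Type) (_ : Field F), Nonempty (F₁ →+* F) ∧ Nonempty (F₂ →+* F) := by
  haveI h₁ : CharP F₁ (ringChar F₁) := ringChar.charP F₁
  haveI h₂ : CharP F₂ (ringChar F₁) := h ▸ ringChar.charP F₂
  rcases CharP.char_is_prime_or_zero F₁ (ringChar F₁) with hp | hp
  · haveI : Fact (ringChar F₁).Prime := ⟨hp⟩
    letI : Algebra (ZMod (ringChar F₁)) F₁ := ZMod.algebra F₁ (ringChar F₁)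
    letI : Algebra (ZMod (ringChar F₁)) F₂ := ZMod.algebra F₂ (ringChar F₁)
    exact exists_field_hom_hom_of_algebra (ZMod (ringChar F₁)) F₁ F₂
  · haveI : CharZero F₁ := by
      haveI : CharP F₁ 0 := hp ▸ h₁
      exact CharP.charP_to_charZero F₁
    haveI : CharZero F₂ := by
      haveI : CharP F₂ 0 := hp ▸ h₂
      exact CharP.charP_to_charZero F₂
    exact exists_field_hom_hom_of_algebra ℚ F₁ F₂

/-- The characteristic is preserved along a field embedding. [folklore] -/
theorem ringChar_eq_of_ringHom {F L : Type} [Field F] [Field L] (f : F →+* L) : ringChar L = ringChar F := by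
  rw [ringChar.eq_iff]
  haveI : CharP F (ringChar F) := ringChar.charP F
  exact (f.charP_iff_charP (ringChar F)).1 inferInstance

/-- **Amalgamation of finitely many fields.** Fields `F i` (`i` in a finite set `s`) of one common characteristic `p`
embed into a single field of characteristic `p`. [folklore] -/
theorem exists_field_forall_hom {ι : Type} (F : ι → Type) [∀ i, Field (F i)] (p : ℕ)
    (hp : p.Prime ∨ p = 0) (h : ∀ i, ringChar (F i) = p) (s : Finset ι) :
    ∃ (L : Type) (_ : Field L), ringChar L = p ∧ ∀ i ∈ s, Nonempty (F i →+* L) := by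
  classical
  induction s using Finset.induction_on with
  | empty =>
    rcases hp with hp | hp
    · haveI : Fact p.Prime := ⟨hp⟩
      exact ⟨ZMod p, inferInstance, ZMod.ringChar_zmod_n p, fun i hi => absurd hi (Finset.notMem_empty i)⟩
    · exact ⟨ℚ, inferInstance, hp ▸ ringChar.eq_zero, fun i hi => absurd hi (Finset.notMem_empty i)⟩
  | insert a s ha ih =>
    obtain ⟨L, _, hL, hs⟩ := ih
    obtain ⟨L', _, ⟨fa⟩, ⟨fL⟩⟩ := exists_field_hom_hom_of_ringChar_eq (F a) L ((h a).trans hL.symm)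
    refine ⟨L', inferInstance, (ringChar_eq_of_ringHom fL).trans hL, fun i hi => ?_⟩
    rcases Finset.mem_insert.1 hi with rfl | hi
    · exact ⟨fa⟩
    · obtain ⟨fi⟩ := hs i hi
      exact ⟨fL.comp fi⟩

/-! ### GRANK data of equal characteristic over one field -/

/-- **One field for two GRANK gates of the same characteristic.** GRANK data `K₀, Kᵢ` over `F₁` and `L₀, Lⱼ` over
`F₂` with `char F₁ = char F₂` can be moved to ONE field `F` without changing either gate: every rank threshold of the
symbolic matrices is preserved (base change, `le_rank_symbolicMatrix_map_iff`). [folklore] -/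
theorem exists_common_field_gRank {F₁ F₂ : Type} [Field F₁] [Field F₂] (h : ringChar F₁ = ringChar F₂)
    {n₁ d₁ n₂ d₂ : ℕ} (K₀ : Matrix (Fin d₁) (Fin d₁) F₁) (K : Fin n₁ → Matrix (Fin d₁) (Fin d₁) F₁)
    (L₀ : Matrix (Fin d₂) (Fin d₂) F₂) (L : Fin n₂ → Matrix (Fin d₂) (Fin d₂) F₂) :
    ∃ (F : Type) (_ : Field F) (f₁ : F₁ →+* F) (f₂ : F₂ →+* F),
      (∀ (θ : ℕ) (v : Fin n₁ → Bool), θ ≤ (symbolicMatrix K₀ K v).rank ↔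
        θ ≤ (symbolicMatrix (K₀.map f₁) (fun i => (K i).map f₁) v).rank) ∧
      (∀ (θ : ℕ) (v : Fin n₂ → Bool), θ ≤ (symbolicMatrix L₀ L v).rank ↔
        θ ≤ (symbolicMatrix (L₀.map f₂) (fun j => (L j).map f₂) v).rank) := by
  obtain ⟨F, _, ⟨f₁⟩, ⟨f₂⟩⟩ := exists_field_hom_hom_of_ringChar_eq F₁ F₂ h
  exact ⟨F, inferInstance, f₁, f₂, fun θ v => (le_rank_symbolicMatrix_map_iff f₁ K₀ K v θ).symm,
    fun θ v => (le_rank_symbolicMatrix_map_iff f₂ L₀ L v θ).symm⟩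

/-- **One field per characteristic for a finite family of GRANK gates.** GRANK data `(K₀ i, K i)` over fields `F i`
of one characteristic `p` (`i` in a finite set `s`) can all be moved to a single field `L` of characteristic `p`
without changing any of the gates. [folklore] -/
theorem exists_common_field_gRank_family : ∀ {ι : Type} (F : ι → Type) [∀ i, Field (F i)] (p : ℕ),
    (p.Prime ∨ p = 0) → (∀ i, ringChar (F i) = p) → ∀ (n d : ι → ℕ)
    (K₀ : ∀ i, Matrix (Fin (d i)) (Fin (d i)) (F i)) (K : ∀ i, Fin (n i) → Matrix (Fin (d i)) (Fin (d i)) (F i))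
    (s : Finset ι), ∃ (L : Type) (_ : Field L), ringChar L = p ∧ ∀ i ∈ s, ∃ f : F i →+* L,
      ∀ (θ : ℕ) (v : Fin (n i) → Bool), θ ≤ (symbolicMatrix (K₀ i) (K i) v).rank ↔
        θ ≤ (symbolicMatrix ((K₀ i).map f) (fun j => (K i j).map f) v).rank := by
  intro ι F _ p hp h n d K₀ K s
  obtain ⟨L, _, hL, hs⟩ := exists_field_forall_hom F p hp h s
  refine ⟨L, inferInstance, hL, fun i hi => ?_⟩
  obtain ⟨f⟩ := hs i hi
  exact ⟨f, fun θ v => (le_rank_symbolicMatrix_map_iff f (K₀ i) (K i) v θ).symm⟩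

end Summit.PneNP.PneNP.Theorems
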